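/-
Copyright: the b2b-balaban T⁴-continuum CRUX team, row NE7b OWNER lineage `t4-ne7b-p1` (gen 138). Project licence.
-/
import Mathlib.Analysis.SpecificLimits.Basic
import Mathlib.Analysis.Normed.Group.InfiniteSum
import Mathlib.Algebra.Order.Field.GeomSum
import Mathlib.Algebra.BigOperators.Intervals
import Mathlib.Tactic.Linarith
import Mathlib.Tactic.Positivity
import Mathlib.Tactic.Ring
import Mathlib.Tactic.FieldSimp

/-!
# THE RELEVANT DIRECTION IS RENORMALISED BY TUNING ITS INITIAL VALUE, THE IRRELEVANT ONES TAKE CARE OF THEMSELVES — the flow of an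
# EXTRACTED coupling `x` along the steps, `x_{k+1} = l·(x_k + δ_k)` with growth factor `l > 1` (the mass-type coupling of (429)∕(431):
# `l = L²`) and bounded sources `|δ_k| ≤ D` (what each fluctuation step deposits into the coupling): (i) two trajectories differ by
# `l^k·(x_0 − x_0′)`, so AT MOST ONE is bounded; (ii) prescribing the value `x_N = a` at ANY horizon `N` determines `x_0` and keeps the
# whole trajectory in the ball `|x_k| ≤ |a| + D·l∕(l−1)` UNIFORMLY IN `N` (the counterterm); (iii) the infinitely tuned start
# `x_0 = −Σ_j l^{−j}δ_j` gives the unique bounded trajectory, `|x_k| ≤ D·l∕(l−1)` for all `k`; (iv) an IRRELEVANT coupling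
# `y_{k+1} = μ(y_k + ε_k)`, `0 ≤ μ < 1`, is bounded from EVERY start and forgets it: `|y_k| ≤ μ^k|y_0| + E·μ∕(1−μ)` — the (β4)
# mechanism «relevant parts renormalised, remainder contracts» of SCOPING (d10) in its linear, given-source form (row NE7b, node U5c;
# Mathlib only; [folklore] affine recursions)

Cell `pub-balaban`, sub-cell `t4`, spine estimate NE7b (`T4WeightBudget.RelWeightBound`; the cell's OWN estimate — NOT PRINTED in
[Bałaban 1983–89], NOT PROVED).  Crux-route work under `Spine/NE7b/` by the row OWNER (`t4-ne7b-p1` gen 138, file (434)) under FREEZE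
(0)'s crux-prover clause; NOTHING of Bałaban's is named as a Lean object, valued or asserted; no `T4Continuum/Support` leaf typed; no
`def`, no notation; zero `sorry`.  Imports: Mathlib only (fast lane).  (430) (the NO for carried letters), (431) (the power-counting
table: `l = L²` for the extracted quadratic coupling, `μ = L⁻¹` for the first irrelevant letter at `d = 4`), (432) (extraction) are met
BY SHAPE: the recursion hypotheses below are their letter maps read on the extracted couplings.

WHY ((430)–(433)).  The fixed-ball test fails for CARRIED relevant letters and passes for the irrelevant remainder; what makes a
renormalisation group nevertheless iterable is that the relevant data are not carried but EXTRACTED as couplings (432) and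
RENORMALISED: their initial values are TUNED so that the trajectory stays bounded — one condition per relevant coupling (the bare
mass, the vacuum-energy subtraction), imposed at the END of the flow and propagated backwards, where the expanding map is
contracting.  THIS FILE is that mechanism for one coupling with its sources GIVEN (the feedback of the coupling on its own sources
— the discrete stable-manifold theorem with a Lipschitz-small feedback — is the next level, located, not typed): the backward
tuning formula, the bound uniform in the horizon, the unique bounded trajectory of the infinite horizon, and, for contrast, the
self-stabilising irrelevant direction with its fading memory of the start.

WHAT IS PROVED ([folklore]; `x δ y ε : ℕ → ℝ`, `l μ D E : ℝ`):
* §1 `discounted_closed_form` (`l ≠ 0`: `l^{−k}x_k = x_0 + Σ_{j<k} l^{−j}δ_j`), `closed_form` (`x_k = l^k·(x_0 + Σ_{j<k} l^{−j}δ_j)`)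
  (the geometric bound `Σ_{i<m} r^i ≤ 1∕(1−r)` is Mathlib's `geom_sum_Ico_le_of_lt_one`).
* §2 INSTABILITY: `difference_eq` (`x_k − x′_k = l^k(x_0 − x′_0)`), **`at_most_one_bounded`** (`l > 1`: two bounded trajectories with the
  same sources have the same start).
* §3 FINITE-HORIZON TUNING: `tuned_initial_value` (`x_N = a ⟹ x_0 = l^{−N}a − Σ_{j<N} l^{−j}δ_j`), **`tuned_trajectory_bound`**
  (`x_N = a`, `|δ| ≤ D`, `l > 1 ⟹ |x_k| ≤ |a| + D·l∕(l−1)` for every `k ≤ N` — uniform in `N`).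
* §4 INFINITE HORIZON: `summable_discounted_source`, **`renormalised_trajectory_bound`** (`x_0 = −Σ′_j l^{−j}δ_j ⟹ |x_k| ≤ D·l∕(l−1)` for
  all `k`).
* §5 IRRELEVANT CONTRAST: **`irrelevant_trajectory_bound`** (`0 ≤ μ < 1`, `|ε| ≤ E ⟹ |y_k| ≤ μ^k|y_0| + E·μ∕(1−μ)`).
* §6 CANONICAL CONSTANTS (`d = 4`, `L ≥ 2`): `canonical_relevant_constant` (`l = L²`: `l∕(l−1) ≤ 4∕3`), `canonical_irrelevant_constant`
  (`μ = L⁻¹`: `μ∕(1−μ) ≤ 1`).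
* §7 toy (kernel): `l = 4`, `δ ≡ 1`: the tuned start for horizon `1` and target `0` is `x_0 = −1`.

HONEST (what this is NOT).  Sources are GIVEN sequences: the real flow feeds the coupling back into its sources (`δ_k = δ_k(x_0,…,x_k)`,
Lipschitz-small in a ball) — the discrete stable-manifold ∕ contraction version is NOT typed (located: Banach fixed point on bounded
sequences with the backward operator of §3); several relevant couplings (mass, vacuum energy, wave-function) are the diagonal case of the
same statement; the marginal coupling (`l = 1`, the quartic — logarithmic flow, the β-function) is NEITHER case and is the β-flow team's
object (B12 Thm 2), not touched.  Nothing of Bałaban's asserted; BY-NAME EFFECT ON THE WALL: NONE.  NE7b NOT PRINTED ∕ NOT PROVED; spine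
PROVED 0∕9; rung (B)+1 — the programme's measures remain FINITE-torus statements; NOT the mass gap, NOT Clay.  HONEST DEPENDENCY:
continuum YM on T⁴ ⇐ BetaPertH ∧ nine spine estimates (0∕9 proved); BetaPertH ⇐ (D1) ∧ (D4) ∧ CAP+tail; G-an2-4 gates asym, D1 and NE2∕3∕4.
-/

set_option autoImplicit false

namespace Summit.QuantumFields.BalabanUV.T4Continuum.NE7b.SupRelevantDirectionTuning

open Finset Filter Topology
open scoped BigOperators

variable {x x' δ y ε : ℕ → ℝ} {l μ D E : ℝ}

/-! ## §1. The closed form -/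

/-- **DISCOUNTED CLOSED FORM**: `x_{k+1} = l(x_k + δ_k)`, `l ≠ 0 ⟹ l^{−k}x_k = x_0 + Σ_{j<k} l^{−j}δ_j`. [folklore] -/
theorem discounted_closed_form (hl : l ≠ 0) (hrec : ∀ k, x (k + 1) = l * (x k + δ k)) :
    ∀ k : ℕ, (l⁻¹) ^ k * x k = x 0 + ∑ j ∈ Finset.range k, (l⁻¹) ^ j * δ j := by
  intro k
  induction k with
  | zero => simp
  | succ k ih =>
    rw [Finset.sum_range_succ, ← add_assoc, ← ih, hrec k, pow_succ]
    field_simp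

/-- **CLOSED FORM**: `x_k = l^k·(x_0 + Σ_{j<k} l^{−j}δ_j)` (`l ≠ 0`). [folklore] -/
theorem closed_form (hl : l ≠ 0) (hrec : ∀ k, x (k + 1) = l * (x k + δ k)) (k : ℕ) :
    x k = l ^ k * (x 0 + ∑ j ∈ Finset.range k, (l⁻¹) ^ j * δ j) := by
  rw [← discounted_closed_form hl hrec k, ← mul_assoc, ← mul_pow, mul_inv_cancel₀ hl, one_pow, one_mul]

/-! ## §2. Instability: at most one bounded trajectory -/

/-- **Two trajectories with the same sources differ by `l^k` times their initial difference.** [folklore] -/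
theorem difference_eq (hrec : ∀ k, x (k + 1) = l * (x k + δ k)) (hrec' : ∀ k, x' (k + 1) = l * (x' k + δ k)) :
    ∀ k : ℕ, x k - x' k = l ^ k * (x 0 - x' 0) := by
  intro k
  induction k with
  | zero => simp
  | succ k ih => rw [hrec k, hrec' k, pow_succ, show l * (x k + δ k) - l * (x' k + δ k) = l * (x k - x' k) by ring, ih]; ring

/-- **AT MOST ONE BOUNDED TRAJECTORY** in an expanding direction (`l > 1`): two bounded solutions with the same sources start at the same
point. [folklore] -/
theorem at_most_one_bounded (hl : 1 < l) (hrec : ∀ k, x (k + 1) = l * (x k + δ k)) (hrec' : ∀ k, x' (k + 1) = l * (x' k + δ k))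
    (hB : ∃ B, ∀ k, |x k| ≤ B) (hB' : ∃ B', ∀ k, |x' k| ≤ B') : x 0 = x' 0 := by
  obtain ⟨B, hB⟩ := hB
  obtain ⟨B', hB'⟩ := hB'
  by_contra hne
  have hpos : 0 < |x 0 - x' 0| := abs_pos.2 (sub_ne_zero.2 hne)
  have ht : Tendsto (fun k : ℕ => l ^ k * |x 0 - x' 0|) atTop atTop := (tendsto_pow_atTop_atTop_of_one_lt hl).atTop_mul_const hpos
  obtain ⟨k, hk⟩ := (ht.eventually_gt_atTop (B + B')).exists
  have h1 : |x k - x' k| ≤ B + B' := (abs_sub _ _).trans (add_le_add (hB k) (hB' k))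
  rw [difference_eq hrec hrec' k, abs_mul, abs_of_pos (pow_pos (by linarith) k)] at h1
  linarith

/-! ## §3. Finite-horizon tuning: the counterterm and the bound uniform in the horizon -/

/-- **THE TUNED INITIAL VALUE**: prescribing `x_N = a` forces `x_0 = l^{−N}a − Σ_{j<N} l^{−j}δ_j` (`l ≠ 0`). [folklore] -/
theorem tuned_initial_value (hl : l ≠ 0) (hrec : ∀ k, x (k + 1) = l * (x k + δ k)) {N : ℕ} {a : ℝ} (hN : x N = a) :
    x 0 = (l⁻¹) ^ N * a - ∑ j ∈ Finset.range N, (l⁻¹) ^ j * δ j := by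
  have h := discounted_closed_form hl hrec N
  rw [hN] at h
  linarith

/-- **THE TUNED TRAJECTORY STAYS IN A BALL, UNIFORMLY IN THE HORIZON**: `x_N = a`, `|δ_k| ≤ D`, `l > 1 ⟹ |x_k| ≤ |a| + D·l∕(l−1)` for every
`k ≤ N` (backwards from the horizon the expanding map contracts: `x_k = l^{k−N}a − Σ_{k≤j<N} l^{k−j}δ_j`). [folklore] -/
theorem tuned_trajectory_bound (hl : 1 < l) (hrec : ∀ k, x (k + 1) = l * (x k + δ k)) (hD : ∀ k, |δ k| ≤ D) {N : ℕ} {a : ℝ}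
    (hN : x N = a) : ∀ k, k ≤ N → |x k| ≤ |a| + D * (l / (l - 1)) := by
  intro k hk
  have hl0 : l ≠ 0 := by positivity
  have hlpos : 0 < l := by linarith
  have hr0 : 0 ≤ l⁻¹ := by positivity
  have hr1 : l⁻¹ < 1 := inv_lt_one_of_one_lt₀ hl
  have hD0 : 0 ≤ D := (abs_nonneg _).trans (hD 0)
  obtain ⟨m, rfl⟩ := Nat.exists_eq_add_of_le hk
  -- discounted forms at `k` and at `k + m`
  have hk' := discounted_closed_form hl0 hrec k
  have hN' := discounted_closed_form hl0 hrec (k + m)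
  rw [hN] at hN'
  have hsplit : ∑ j ∈ Finset.range (k + m), (l⁻¹) ^ j * δ j =
      ∑ j ∈ Finset.range k, (l⁻¹) ^ j * δ j + ∑ i ∈ Finset.range m, (l⁻¹) ^ (k + i) * δ (k + i) := by
    rw [← Finset.sum_range_add_sum_Ico _ (Nat.le_add_right k m), Finset.sum_Ico_eq_sum_range, Nat.add_sub_cancel_left]
  -- hence `l^{-k} x_k = l^{-(k+m)} a − Σ_{i<m} l^{-(k+i)} δ_{k+i}`
  have hxk : (l⁻¹) ^ k * x k = (l⁻¹) ^ (k + m) * a - ∑ i ∈ Finset.range m, (l⁻¹) ^ (k + i) * δ (k + i) := by linarith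
  -- multiply by `l^k`
  have hk1 : l ^ k * (l⁻¹) ^ k = 1 := by rw [← mul_pow, mul_inv_cancel₀ hl0, one_pow]
  have hxk' : x k = (l⁻¹) ^ m * a - ∑ i ∈ Finset.range m, (l⁻¹) ^ i * δ (k + i) := by
    have h1 : x k = l ^ k * ((l⁻¹) ^ k * x k) := by rw [← mul_assoc, hk1, one_mul]
    rw [h1, hxk, mul_sub, Finset.mul_sum]
    congr 1
    · rw [pow_add, ← mul_assoc, ← mul_assoc, hk1, one_mul]
    · refine Finset.sum_congr rfl fun i _ => ?_
      rw [pow_add, ← mul_assoc, ← mul_assoc, hk1, one_mul]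
  rw [hxk']
  have hterm1 : |(l⁻¹) ^ m * a| ≤ |a| := by
    rw [abs_mul, abs_of_nonneg (pow_nonneg hr0 m)]
    exact mul_le_of_le_one_left (abs_nonneg a) (pow_le_one₀ hr0 hr1.le)
  have hterm2 : |∑ i ∈ Finset.range m, (l⁻¹) ^ i * δ (k + i)| ≤ D * (l / (l - 1)) := by
    calc |∑ i ∈ Finset.range m, (l⁻¹) ^ i * δ (k + i)| ≤ ∑ i ∈ Finset.range m, |(l⁻¹) ^ i * δ (k + i)| := Finset.abs_sum_le_sum_abs _ _
      _ ≤ ∑ i ∈ Finset.range m, (l⁻¹) ^ i * D := Finset.sum_le_sum fun i _ => by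
          rw [abs_mul, abs_of_nonneg (pow_nonneg hr0 i)]
          exact mul_le_mul_of_nonneg_left (hD _) (pow_nonneg hr0 i)
      _ = D * ∑ i ∈ Finset.range m, (l⁻¹) ^ i := by rw [← Finset.sum_mul, mul_comm]
      _ ≤ D * (1 / (1 - l⁻¹)) := by
          refine mul_le_mul_of_nonneg_left ?_ hD0
          -- Mathlib's `geom_sum_Ico_le_of_lt_one` on `Ico 0 m = range m`
          have hg := geom_sum_Ico_le_of_lt_one hr0 hr1 (m := 0) (n := m)
          rwa [pow_zero, ← Finset.range_eq_Ico] at hg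
      _ = D * (l / (l - 1)) := by
          congr 1
          field_simp
  calc |(l⁻¹) ^ m * a - ∑ i ∈ Finset.range m, (l⁻¹) ^ i * δ (k + i)|
      ≤ |(l⁻¹) ^ m * a| + |∑ i ∈ Finset.range m, (l⁻¹) ^ i * δ (k + i)| := abs_sub _ _
    _ ≤ |a| + D * (l / (l - 1)) := add_le_add hterm1 hterm2

/-! ## §4. Infinite horizon: the renormalised trajectory -/

/-- The discounted sources are summable (`|δ| ≤ D`, `l > 1`). [folklore] -/
theorem summable_discounted_source (hl : 1 < l) (hD : ∀ k, |δ k| ≤ D) : Summable fun j : ℕ => (l⁻¹) ^ j * δ j := by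
  have hr0 : 0 ≤ l⁻¹ := by positivity
  have hr1 : l⁻¹ < 1 := inv_lt_one_of_one_lt₀ hl
  refine Summable.of_norm_bounded ((summable_geometric_of_lt_one hr0 hr1).mul_left D) fun j => ?_
  rw [Real.norm_eq_abs, abs_mul, abs_of_nonneg (pow_nonneg hr0 j), mul_comm]
  exact mul_le_mul_of_nonneg_right (hD j) (pow_nonneg hr0 j)

/-- **THE RENORMALISED TRAJECTORY**: starting from the infinitely tuned value `x_0 = −Σ′_j l^{−j}δ_j`, the trajectory is
`x_k = −Σ′_j l^{−j}δ_{j+k}` and stays in the ball `|x_k| ≤ D·l∕(l−1)` for EVERY `k` (`l > 1`, `|δ| ≤ D`). [folklore] -/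
theorem renormalised_trajectory_bound (hl : 1 < l) (hrec : ∀ k, x (k + 1) = l * (x k + δ k)) (hD : ∀ k, |δ k| ≤ D)
    (hx0 : x 0 = -∑' j : ℕ, (l⁻¹) ^ j * δ j) : ∀ k : ℕ, |x k| ≤ D * (l / (l - 1)) := by
  intro k
  have hl0 : l ≠ 0 := by positivity
  have hr0 : 0 ≤ l⁻¹ := by positivity
  have hr1 : l⁻¹ < 1 := inv_lt_one_of_one_lt₀ hl
  have hD0 : 0 ≤ D := (abs_nonneg _).trans (hD 0)
  have hs := summable_discounted_source hl hD
  -- the shifted discounted sources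
  have hDk : ∀ j, |δ (j + k)| ≤ D := fun j => hD _
  have hsk : Summable fun j : ℕ => (l⁻¹) ^ j * δ (j + k) := summable_discounted_source (δ := fun j => δ (j + k)) hl hDk
  -- `x_k = − Σ' l^{-j} δ_{j+k}`
  have hk1 : l ^ k * (l⁻¹) ^ k = 1 := by rw [← mul_pow, mul_inv_cancel₀ hl0, one_pow]
  have hxk : x k = -∑' j : ℕ, (l⁻¹) ^ j * δ (j + k) := by
    have hsplit := hs.sum_add_tsum_nat_add k
    have h1 : x 0 + ∑ j ∈ Finset.range k, (l⁻¹) ^ j * δ j = -∑' j : ℕ, (l⁻¹) ^ (j + k) * δ (j + k) := by rw [hx0]; linarith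
    rw [closed_form hl0 hrec k, h1, mul_neg, ← tsum_mul_left]
    congr 1
    refine tsum_congr fun j => ?_
    calc l ^ k * ((l⁻¹) ^ (j + k) * δ (j + k)) = (l ^ k * (l⁻¹) ^ k) * ((l⁻¹) ^ j * δ (j + k)) := by rw [pow_add]; ring
      _ = (l⁻¹) ^ j * δ (j + k) := by rw [hk1, one_mul]
  rw [hxk, abs_neg]
  have hbound : ∀ j : ℕ, ‖(l⁻¹) ^ j * δ (j + k)‖ ≤ D * (l⁻¹) ^ j := by
    intro j
    rw [Real.norm_eq_abs, abs_mul, abs_of_nonneg (pow_nonneg hr0 j), mul_comm]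
    exact mul_le_mul_of_nonneg_right (hD _) (pow_nonneg hr0 j)
  have hgeo : Summable fun j : ℕ => D * (l⁻¹) ^ j := (summable_geometric_of_lt_one hr0 hr1).mul_left D
  have hnorm : Summable fun j : ℕ => ‖(l⁻¹) ^ j * δ (j + k)‖ :=
    Summable.of_norm_bounded hgeo fun j => by rw [Real.norm_eq_abs, abs_of_nonneg (norm_nonneg _)]; exact hbound j
  calc |∑' j : ℕ, (l⁻¹) ^ j * δ (j + k)| = ‖∑' j : ℕ, (l⁻¹) ^ j * δ (j + k)‖ := (Real.norm_eq_abs _).symm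
    _ ≤ ∑' j : ℕ, ‖(l⁻¹) ^ j * δ (j + k)‖ := norm_tsum_le_tsum_norm hnorm
    _ ≤ ∑' j : ℕ, D * (l⁻¹) ^ j := Summable.tsum_le_tsum hbound hnorm hgeo
    _ = D * (1 - l⁻¹)⁻¹ := by rw [tsum_mul_left, tsum_geometric_of_lt_one hr0 hr1]
    _ = D * (l / (l - 1)) := by
        congr 1
        field_simp

/-! ## §5. The irrelevant contrast -/

/-- **AN IRRELEVANT COUPLING IS BOUNDED FROM EVERY START AND FORGETS IT**: `y_{k+1} = μ(y_k + ε_k)`, `0 ≤ μ < 1`, `|ε_k| ≤ E ⟹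
|y_k| ≤ μ^k|y_0| + E·μ∕(1−μ)`. [folklore] -/
theorem irrelevant_trajectory_bound (hμ0 : 0 ≤ μ) (hμ1 : μ < 1) (hrec : ∀ k, y (k + 1) = μ * (y k + ε k)) (hE : ∀ k, |ε k| ≤ E) :
    ∀ k : ℕ, |y k| ≤ μ ^ k * |y 0| + E * (μ / (1 - μ)) := by
  have h1μ : 0 < 1 - μ := by linarith
  intro k
  induction k with
  | zero =>
    have hE0 : 0 ≤ E := (abs_nonneg _).trans (hE 0)
    rw [pow_zero, one_mul]
    exact le_add_of_nonneg_right (mul_nonneg hE0 (div_nonneg hμ0 h1μ.le))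
  | succ k ih =>
    rw [hrec k, abs_mul, abs_of_nonneg hμ0, pow_succ]
    have h1 : |y k + ε k| ≤ μ ^ k * |y 0| + E * (μ / (1 - μ)) + E := (abs_add_le _ _).trans (add_le_add ih (hE k))
    have h2 : μ * (μ ^ k * |y 0| + E * (μ / (1 - μ)) + E) = μ ^ k * μ * |y 0| + E * (μ / (1 - μ)) := by
      field_simp
      ring
    calc μ * |y k + ε k| ≤ μ * (μ ^ k * |y 0| + E * (μ / (1 - μ)) + E) := mul_le_mul_of_nonneg_left h1 hμ0
      _ = μ ^ k * μ * |y 0| + E * (μ / (1 - μ)) := h2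

/-! ## §6. The canonical constants at `d = 4` -/

/-- **The relevant constant**: for the mass-type coupling `l = L²` with `L ≥ 2`, `l∕(l−1) ≤ 4∕3`. [folklore] -/
theorem canonical_relevant_constant {L : ℝ} (hL : 2 ≤ L) : L ^ 2 / (L ^ 2 - 1) ≤ 4 / 3 := by
  have h1 : 0 < L ^ 2 - 1 := by nlinarith
  rw [div_le_div_iff₀ h1 (by norm_num : (0 : ℝ) < 3)]
  nlinarith

/-- **The irrelevant constant**: for the first irrelevant letter `μ = L⁻¹` with `L ≥ 2`, `μ∕(1−μ) = 1∕(L−1) ≤ 1`. [folklore] -/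
theorem canonical_irrelevant_constant {L : ℝ} (hL : 2 ≤ L) : L⁻¹ / (1 - L⁻¹) ≤ 1 := by
  have hL0 : 0 < L := by linarith
  have h1 : L⁻¹ / (1 - L⁻¹) = 1 / (L - 1) := by
    field_simp
  rw [h1, div_le_one (by linarith)]
  linarith

/-! ## §7. Toy -/

/-- Toy (kernel): `l = 4`, `δ ≡ 1`, horizon `N = 1`, target `a = 0`: the tuned start is `x_0 = 4⁻¹·0 − 1 = −1`. -/
example (hrec : ∀ k, x (k + 1) = 4 * (x k + 1)) (h1 : x 1 = 0) : x 0 = -1 := by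
  have h := tuned_initial_value (δ := fun _ => 1) (by norm_num) hrec h1
  simpa using h

end Summit.QuantumFields.BalabanUV.T4Continuum.NE7b.SupRelevantDirectionTuning
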